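import Summits.CriticalPhenomena.PercolationContinuityZ3.Theorems.PercNearOneGluingNoHeavyLowerTailAntipodalR1PocketBijection
import HarnessLib

/-!
# The pocket flip, VI: the second pocket — elements of `L` singly attached at `b`

Support file for `stmt-CriticalPhenomena-4575` (memo `prim-gen-kcluster/KCLUSTER-gen78.md` §3.5 "second pocket",
`KCLUSTER-gen82.md` §2; conjecture ANTI₁-GRADED of `KCLUSTER-gen52.md` §3, whose per-level form on irreducible
instances is the hypothesis `Hirr` of `AntipodalR1.card_lSet_grade_le_of_irreducible`).  No definitions, no named
facts, no sorries.  Continuation of parts I–V (`…PocketFlip`, `…PocketGrade`, `…PocketInvolution`,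
`…PocketBijection`, `…PocketResidual`); terminology as there: `x ∈ L` is *singly attached at `c`* if every vertex
outside the pocket `Q_c = region ends x a c` adjacent to it is joined to `a` by an open path of `x` avoiding `Q_c`,
and *singly attached at `b`* for the same condition with `Q_b = region ends x a b`; `y ∈ R(b,c)` is *singly
attached at `c`* if every outside neighbour of `S = region ends ȳ a c` is joined to `a` by a CLOSED path of `y`
avoiding `S`.

The **second pocket map** is `Ψ_b(x) = σ(Φ_b(x))`: flip every edge touching the pocket of `b`, then complement
every edge.  Since `L` is symmetric in the terminals and the global complement `σ` maps `R(c,b)` onto `R(b,c)`,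
parts I–III at the terminal `b` give at once: for `x ∈ L` singly attached at `b`, `Ψ_b(x) ∈ R(b,c)`, with the same
grade, injectively.  The new point of this file is WHERE the image lies:

* `AntipodalR1.openPath_of_pocketFlip_avoid`: an open path of `Φ_b(x)` from `a` avoiding a set `S` never enters
  the pocket of `b` (its boundary edges are closed after the flip), so it is an open path of `x` avoiding `S`;
* `AntipodalR1.region_pocketFlip_other`: the pocket of `c` is unchanged by the flip at `b`
  (`region ends (Φ_b x) a c = region ends x a c`, using the separation `c ∉ region ends x a b`);
* `AntipodalR1.not_attached_psi`: hence **if `x ∈ L` is NOT singly attached at `c`, then `Ψ_b(x)` is NOT singly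
  attached at `c` on the `R` side** — the image of the elements singly attached at `b` but not at `c` is disjoint
  from the image `R(b,c)^{c-att}` of the first pocket flip (part IV);
* `AntipodalR1.card_lSet_attachedB_grade_le`: for every level `t`,
  `#{x ∈ L : not c-attached, b-attached, g = t} ≤ #{y ∈ R(b,c) : not c-attached, g = t}`;
* `AntipodalR1.card_lSet_attached_or_grade_le`: **ANTI₁-GRADED holds for the part of `L` with at least one
  singly attached terminal pocket**: `#{x ∈ L : c-attached ∨ b-attached, g = t} ≤ #{y ∈ R(b,c) : g = t}` for every
  finite edge system, all `a, b, c` and every level `t`.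
Numerically (memo gen78 §3.5, gen82 §2) this part is 90.5 % of `L` on the irreducible instances with `n ≤ 6`,
91.4 % at `n = 7`, 84.2 % at `n = 8`; the open residue of `Hirr` is the set of elements whose two terminal pockets
are both multiply attached.  (The symmetric guess `#L^{¬b,¬c}_t ≤ #R^{¬b,¬c}_t` is FALSE — 50 of 412 irreducible
instances at `n ≤ 6` — the residue also needs the images `Ψ_b(x)` of doubly attached `x` that are not
`c`-attached on the `R` side; memo gen82 §2.)  [this work]
-/

namespace Summit.CriticalPhenomena.PercolationContinuityZ3.Theorems

namespace AntipodalR1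

open Finset Relation SimpleGraph

variable {V ι : Type*}

section SecondPocket

variable {ends : ι → Sym2 V} {x y z : ι → Bool} {a b c : V}

open Classical in
/-- **Open paths of the flip at `b` avoid the pocket of `b`.**  If `z = Φ_b(x)` (every edge touching
`Q_b = region ends x a b` reversed) and `b ∉ K_a(x)`, then an open path of `z` from `a` whose vertices avoid a set
`S` is an open path of `x` avoiding `S` (and it never meets `Q_b`). [this work] -/
theorem openPath_of_pocketFlip_avoid (hb : b ∉ clus ends x false a)
    (hz : ∀ e, z e = if (∃ v, v ∈ ends e ∧ v ∈ region ends x a b) then !x e else x e)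
    {S : Set V} {v : V}
    (hv : ReflTransGen (fun u w => w ∈ nbr ends z true u ∧ u ∉ S ∧ w ∉ S) a v) :
    ReflTransGen (fun u w => w ∈ nbr ends x true u ∧ u ∉ S ∧ w ∉ S) a v ∧ v ∉ region ends x a b := by
  induction hv with
  | refl => exact ⟨ReflTransGen.refl, apex_not_mem_pocket hb⟩
  | @tail u w _ huw ih =>
    obtain ⟨hpath, huQ⟩ := ih
    obtain ⟨⟨e, hze, he⟩, huS, hwS⟩ := huw
    have hnt : ¬ ∃ v, v ∈ ends e ∧ v ∈ region ends x a b := by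
      intro ht
      have hxe := (open_and_mem_clus_of_touch hb ht (by rw [he]; exact Sym2.mem_mk_left _ _) huQ).1
      rw [pocketFlip_of_touch hz ht, hxe] at hze
      exact Bool.false_ne_true hze
    have hxe : x e = true := by rw [← pocketFlip_of_not_touch hz hnt]; exact hze
    have hwQ : w ∉ region ends x a b := fun hwQ =>
      hnt ⟨w, by rw [he]; exact Sym2.mem_mk_right _ _, hwQ⟩
    exact ⟨hpath.tail ⟨⟨e, hxe, he⟩, huS, hwS⟩, hwQ⟩

open Classical in
/-- **The flip at `b` does not change the pocket of `c`**: for `x` with `b ∉ K_a(x)` and `K_a(x)` separating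
`b` from `c`, `region ends (Φ_b x) a c = region ends x a c`. [this work] -/
theorem region_pocketFlip_other (hb : b ∉ clus ends x false a) (hc : c ∉ clus ends x false a)
    (hsep : c ∉ region ends x a b)
    (hz : ∀ e, z e = if (∃ v, v ∈ ends e ∧ v ∈ region ends x a b) then !x e else x e) :
    region ends z a c = region ends x a c := by
  ext v
  constructor
  · intro hv
    rw [mem_region] at hv ⊢
    refine path_mono (fun u w h => ?_) hv
    obtain ⟨hadj, huK, hwK⟩ := h
    exact ⟨hadj, fun h' => huK (clus_false_subset_pocketFlip hb hz h'),
      fun h' => hwK (clus_false_subset_pocketFlip hb hz h')⟩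
  · intro hv
    rw [mem_region] at hv ⊢
    -- every vertex of the pocket of `c` avoids `K_a(z) ⊆ K_a(x) ∪ Q_b`
    have key : ∀ {u}, ReflTransGen (fun u w => w ∈ freeNbr ends x a u) c u → u ∉ clus ends z false a := by
      intro u hcu huz
      rcases pocketFlip_clus_false_subset hb hz huz with huK | huQ
      · exact not_mem_clus_of_region hc hcu huK
      · exact hsep ((mem_region.1 huQ).trans (region_symm hcu))
    induction hv with
    | refl => exact ReflTransGen.refl
    | @tail u w hcu huw ih =>
      obtain ⟨hadj, huK, hwK⟩ := huw
      exact ih.tail ⟨hadj, key hcu, key (hcu.tail ⟨hadj, huK, hwK⟩)⟩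

open Classical in
/-- The complement of the flip at `b`, edgewise. [this work] -/
theorem psi_flip_eq (hy : ∀ i, y i = !z i) : (fun i => !y i) = z :=
  funext fun i => by rw [hy i, Bool.not_not]

/-- The global complement maps `R(c,b)` into `R(b,c)`. [this work] -/
theorem flip_mem_rSet_comm [Fintype ι] [DecidableEq ι] (hz : z ∈ rSet ends a c b) (hy : ∀ i, y i = !z i) :
    y ∈ rSet ends a b c := by
  have hyz : y = fun i => !z i := funext hy
  obtain ⟨h1, h2, h3, h4⟩ := mem_rSet.1 hz
  subst hyz
  refine mem_rSet.2 ⟨?_, ?_, ?_, ?_⟩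
  · rw [mem_clus_flip]; exact h3
  · rw [mem_clus_flip]; exact h4
  · rw [mem_clus_flip]; exact h1
  · rw [mem_clus_flip]; exact h2

open Classical in
/-- **`Ψ_b(x) ∈ R(b,c)`** for `x ∈ L` singly attached at `b` (parts I at the terminal `b`, then `σ`). [this work] -/
theorem psi_mem_rSet [Fintype ι] [DecidableEq ι] (hx : x ∈ lSet ends a b c)
    (hz : ∀ e, z e = if (∃ v, v ∈ ends e ∧ v ∈ region ends x a b) then !x e else x e)
    (hy : ∀ i, y i = !z i)
    (hattB : ∀ w, w ∉ region ends x a b → (∃ e u, ends e = s(w, u) ∧ u ∈ region ends x a b) →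
      ReflTransGen (fun u w => w ∈ nbr ends x true u ∧
        u ∉ region ends x a b ∧ w ∉ region ends x a b) a w) :
    y ∈ rSet ends a b c := by
  have hx' : x ∈ lSet ends a c b := by rw [← lSet_comm]; exact hx
  exact flip_mem_rSet_comm (pocketFlip_mem_rSet hx' hz hattB) hy

open Classical in
/-- **`Ψ_b` preserves the grade** on elements singly attached at `b` (part II at `b`, then `σ`). [this work] -/
theorem grade_psi [Finite V] (hb : b ∉ clus ends x false a)
    (hz : ∀ e, z e = if (∃ v, v ∈ ends e ∧ v ∈ region ends x a b) then !x e else x e)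
    (hy : ∀ i, y i = !z i)
    (hattB : ∀ w, w ∉ region ends x a b → (∃ e u, ends e = s(w, u) ∧ u ∈ region ends x a b) →
      ReflTransGen (fun u w => w ∈ nbr ends x true u ∧
        u ∉ region ends x a b ∧ w ∉ region ends x a b) a w) :
    Nat.card (fromEdgeSet {s : Sym2 V | ∃ e, y e = true ∧ ends e = s}).ConnectedComponent +
        Nat.card (fromEdgeSet {s : Sym2 V | ∃ e, y e = false ∧ ends e = s}).ConnectedComponent =
      Nat.card (fromEdgeSet {s : Sym2 V | ∃ e, x e = true ∧ ends e = s}).ConnectedComponent +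
        Nat.card (fromEdgeSet {s : Sym2 V | ∃ e, x e = false ∧ ends e = s}).ConnectedComponent := by
  have hyz : y = fun i => !z i := funext hy
  subst hyz
  rw [grade_flip]
  exact grade_pocketFlip hb hz hattB

open Classical in
/-- **The image of `Ψ_b` on elements not attached at `c` avoids the `c`-attached part of `R(b,c)`.**  If
`x ∈ L` is not singly attached at `c`, then `y = Ψ_b(x)` is not singly attached at `c` on the `R` side: the pocket
`region ends ȳ a c` is the old pocket of `c`, and a closed path of `y` = an open path of `Φ_b(x)` from `a` avoiding
it would be an open path of `x` avoiding it. [this work] -/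
theorem not_attached_psi (hb : b ∉ clus ends x false a) (hc : c ∉ clus ends x false a)
    (hsep : c ∉ region ends x a b)
    (hz : ∀ e, z e = if (∃ v, v ∈ ends e ∧ v ∈ region ends x a b) then !x e else x e)
    (hy : ∀ i, y i = !z i)
    (hnatt : ¬ ∀ w, w ∉ region ends x a c → (∃ e u, ends e = s(w, u) ∧ u ∈ region ends x a c) →
      ReflTransGen (fun u w => w ∈ nbr ends x true u ∧
        u ∉ region ends x a c ∧ w ∉ region ends x a c) a w) :
    ¬ ∀ w, w ∉ region ends (fun i => !y i) a c →
      (∃ e u, ends e = s(w, u) ∧ u ∈ region ends (fun i => !y i) a c) →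
      ReflTransGen (fun u w => w ∈ nbr ends y false u ∧
        u ∉ region ends (fun i => !y i) a c ∧ w ∉ region ends (fun i => !y i) a c) a w := by
  intro hatt
  apply hnatt
  have hQ : region ends (fun i => !y i) a c = region ends x a c := by
    rw [psi_flip_eq hy, region_pocketFlip_other hb hc hsep hz]
  have hnbr : nbr ends y false = nbr ends z true := by
    rw [← psi_flip_eq hy, nbr_flip, Bool.not_true]
  rw [hQ, hnbr] at hatt
  intro w hw hadj
  exact (openPath_of_pocketFlip_avoid hb hz (hatt w hw hadj)).1

open Classical in
/-- `Ψ_b` is injective on the elements of `L` singly attached at `b`. [this work] -/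
theorem psi_injOn {x₁ x₂ y₁ y₂ : ι → Bool} (hb₁ : b ∉ clus ends x₁ false a) (hb₂ : b ∉ clus ends x₂ false a)
    (hy₁ : ∀ e, y₁ e = !(if (∃ v, v ∈ ends e ∧ v ∈ region ends x₁ a b) then !x₁ e else x₁ e))
    (hy₂ : ∀ e, y₂ e = !(if (∃ v, v ∈ ends e ∧ v ∈ region ends x₂ a b) then !x₂ e else x₂ e))
    (hatt₁ : ∀ w, w ∉ region ends x₁ a b → (∃ e u, ends e = s(w, u) ∧ u ∈ region ends x₁ a b) →
      ReflTransGen (fun u w => w ∈ nbr ends x₁ true u ∧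
        u ∉ region ends x₁ a b ∧ w ∉ region ends x₁ a b) a w)
    (hatt₂ : ∀ w, w ∉ region ends x₂ a b → (∃ e u, ends e = s(w, u) ∧ u ∈ region ends x₂ a b) →
      ReflTransGen (fun u w => w ∈ nbr ends x₂ true u ∧
        u ∉ region ends x₂ a b ∧ w ∉ region ends x₂ a b) a w)
    (h : y₁ = y₂) : x₁ = x₂ := by
  refine pocketFlip_injOn hb₁ hb₂
    (y := fun e => if (∃ v, v ∈ ends e ∧ v ∈ region ends x₁ a b) then !x₁ e else x₁ e)
    (fun _ => rfl) (fun e => ?_) hatt₁ hatt₂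
  have h1 := hy₁ e
  have h2 := hy₂ e
  rw [h] at h1
  rw [h1] at h2
  exact Bool.not_inj h2

end SecondPocket

section Counting

variable [Finite V] [Fintype ι] [DecidableEq ι] (ends : ι → Sym2 V) (a b c : V)

open Classical in
/-- **The second pocket injection.**  For every level `t`:
`#{x ∈ L : not c-attached, b-attached, g(x) = t} ≤ #{y ∈ R(b,c) : not c-attached (R side), g(y) = t}`,
by `Ψ_b`. [this work] -/
theorem card_lSet_attachedB_grade_le (t : ℕ) :
    ((lSet ends a b c).filter fun x =>
        (¬ ∀ w, w ∉ region ends x a c → (∃ e u, ends e = s(w, u) ∧ u ∈ region ends x a c) →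
          ReflTransGen (fun u w => w ∈ nbr ends x true u ∧
            u ∉ region ends x a c ∧ w ∉ region ends x a c) a w) ∧
        (∀ w, w ∉ region ends x a b → (∃ e u, ends e = s(w, u) ∧ u ∈ region ends x a b) →
          ReflTransGen (fun u w => w ∈ nbr ends x true u ∧
            u ∉ region ends x a b ∧ w ∉ region ends x a b) a w) ∧
        Nat.card (fromEdgeSet {s : Sym2 V | ∃ e, x e = true ∧ ends e = s}).ConnectedComponent +
          Nat.card (fromEdgeSet {s : Sym2 V | ∃ e, x e = false ∧ ends e = s}).ConnectedComponent = t).card ≤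
      ((rSet ends a b c).filter fun y =>
        (¬ ∀ w, w ∉ region ends (fun i => !y i) a c →
          (∃ e u, ends e = s(w, u) ∧ u ∈ region ends (fun i => !y i) a c) →
          ReflTransGen (fun u w => w ∈ nbr ends y false u ∧
            u ∉ region ends (fun i => !y i) a c ∧ w ∉ region ends (fun i => !y i) a c) a w) ∧
        Nat.card (fromEdgeSet {s : Sym2 V | ∃ e, y e = true ∧ ends e = s}).ConnectedComponent +
          Nat.card (fromEdgeSet {s : Sym2 V | ∃ e, y e = false ∧ ends e = s}).ConnectedComponent = t).card := by
  refine Finset.card_le_card_of_injOn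
    (fun x e => !(if (∃ v, v ∈ ends e ∧ v ∈ region ends x a b) then !x e else x e)) ?_ ?_
  · intro x hx
    rw [Finset.mem_coe, Finset.mem_filter] at hx
    obtain ⟨hxL, hnattC, hattB, hxg⟩ := hx
    obtain ⟨-, hbK, -, hcK, hsep⟩ := mem_lSet.1 hxL
    rw [Finset.mem_coe, Finset.mem_filter]
    refine ⟨psi_mem_rSet hxL (z := fun e => if (∃ v, v ∈ ends e ∧ v ∈ region ends x a b) then !x e else x e)
        (fun _ => rfl) (fun _ => rfl) hattB,
      not_attached_psi hbK hcK hsep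
        (z := fun e => if (∃ v, v ∈ ends e ∧ v ∈ region ends x a b) then !x e else x e)
        (fun _ => rfl) (fun _ => rfl) hnattC, ?_⟩
    rw [← hxg]
    exact grade_psi hbK (z := fun e => if (∃ v, v ∈ ends e ∧ v ∈ region ends x a b) then !x e else x e)
      (fun _ => rfl) (fun _ => rfl) hattB
  · intro x₁ hx₁ x₂ hx₂ h
    rw [Finset.mem_coe, Finset.mem_filter] at hx₁ hx₂
    exact psi_injOn (mem_lSet.1 hx₁.1).2.1 (mem_lSet.1 hx₂.1).2.1
      (y₁ := fun e => !(if (∃ v, v ∈ ends e ∧ v ∈ region ends x₁ a b) then !x₁ e else x₁ e))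
      (y₂ := fun e => !(if (∃ v, v ∈ ends e ∧ v ∈ region ends x₂ a b) then !x₂ e else x₂ e))
      (fun _ => rfl) (fun _ => rfl) hx₁.2.2.1 hx₂.2.2.1 h

open Classical in
/-- **ANTI₁-GRADED FOR THE ELEMENTS WITH A SINGLY ATTACHED TERMINAL POCKET.**  For every finite edge system,
all `a, b, c` and every level `t`:
`#{x ∈ L : x singly attached at c ∨ at b, g(x) = t} ≤ #{y ∈ R(b,c) : g(y) = t}`.
The `c`-attached elements go by the pocket flip `Φ_c` into the `c`-attached part of `R(b,c)` (part III), the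
others by `Ψ_b` into its complement (`card_lSet_attachedB_grade_le`). [this work] -/
theorem card_lSet_attached_or_grade_le (t : ℕ) :
    ((lSet ends a b c).filter fun x =>
        ((∀ w, w ∉ region ends x a c → (∃ e u, ends e = s(w, u) ∧ u ∈ region ends x a c) →
            ReflTransGen (fun u w => w ∈ nbr ends x true u ∧
              u ∉ region ends x a c ∧ w ∉ region ends x a c) a w) ∨
          (∀ w, w ∉ region ends x a b → (∃ e u, ends e = s(w, u) ∧ u ∈ region ends x a b) →
            ReflTransGen (fun u w => w ∈ nbr ends x true u ∧
              u ∉ region ends x a b ∧ w ∉ region ends x a b) a w)) ∧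
        Nat.card (fromEdgeSet {s : Sym2 V | ∃ e, x e = true ∧ ends e = s}).ConnectedComponent +
          Nat.card (fromEdgeSet {s : Sym2 V | ∃ e, x e = false ∧ ends e = s}).ConnectedComponent = t).card ≤
      ((rSet ends a b c).filter fun y =>
        Nat.card (fromEdgeSet {s : Sym2 V | ∃ e, y e = true ∧ ends e = s}).ConnectedComponent +
          Nat.card (fromEdgeSet {s : Sym2 V | ∃ e, y e = false ∧ ends e = s}).ConnectedComponent = t).card := by
  have h1 := card_lSet_attached_grade_le ends a b c t
  have h2 := card_lSet_attachedB_grade_le ends a b c t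
  -- split the left side by attachment at `c`
  have splitL := Finset.card_filter_add_card_filter_not
    (s := (lSet ends a b c).filter fun x =>
        ((∀ w, w ∉ region ends x a c → (∃ e u, ends e = s(w, u) ∧ u ∈ region ends x a c) →
            ReflTransGen (fun u w => w ∈ nbr ends x true u ∧
              u ∉ region ends x a c ∧ w ∉ region ends x a c) a w) ∨
          (∀ w, w ∉ region ends x a b → (∃ e u, ends e = s(w, u) ∧ u ∈ region ends x a b) →
            ReflTransGen (fun u w => w ∈ nbr ends x true u ∧
              u ∉ region ends x a b ∧ w ∉ region ends x a b) a w)) ∧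
        Nat.card (fromEdgeSet {s : Sym2 V | ∃ e, x e = true ∧ ends e = s}).ConnectedComponent +
          Nat.card (fromEdgeSet {s : Sym2 V | ∃ e, x e = false ∧ ends e = s}).ConnectedComponent = t)
    (fun x : ι → Bool => ∀ w, w ∉ region ends x a c → (∃ e u, ends e = s(w, u) ∧ u ∈ region ends x a c) →
      ReflTransGen (fun u w => w ∈ nbr ends x true u ∧
        u ∉ region ends x a c ∧ w ∉ region ends x a c) a w)
  -- split the right side by attachment at `c` (R side)
  have splitR := Finset.card_filter_add_card_filter_not
    (s := (rSet ends a b c).filter fun y =>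
      Nat.card (fromEdgeSet {s : Sym2 V | ∃ e, y e = true ∧ ends e = s}).ConnectedComponent +
        Nat.card (fromEdgeSet {s : Sym2 V | ∃ e, y e = false ∧ ends e = s}).ConnectedComponent = t)
    (fun y : ι → Bool => ∀ w, w ∉ region ends (fun i => !y i) a c →
      (∃ e u, ends e = s(w, u) ∧ u ∈ region ends (fun i => !y i) a c) →
      ReflTransGen (fun u w => w ∈ nbr ends y false u ∧
        u ∉ region ends (fun i => !y i) a c ∧ w ∉ region ends (fun i => !y i) a c) a w)
  rw [Finset.filter_filter, Finset.filter_filter] at splitL splitR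
  have eL1 : ((lSet ends a b c).filter fun x =>
      (((∀ w, w ∉ region ends x a c → (∃ e u, ends e = s(w, u) ∧ u ∈ region ends x a c) →
            ReflTransGen (fun u w => w ∈ nbr ends x true u ∧
              u ∉ region ends x a c ∧ w ∉ region ends x a c) a w) ∨
          (∀ w, w ∉ region ends x a b → (∃ e u, ends e = s(w, u) ∧ u ∈ region ends x a b) →
            ReflTransGen (fun u w => w ∈ nbr ends x true u ∧
              u ∉ region ends x a b ∧ w ∉ region ends x a b) a w)) ∧
        Nat.card (fromEdgeSet {s : Sym2 V | ∃ e, x e = true ∧ ends e = s}).ConnectedComponent +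
          Nat.card (fromEdgeSet {s : Sym2 V | ∃ e, x e = false ∧ ends e = s}).ConnectedComponent = t) ∧
      (∀ w, w ∉ region ends x a c → (∃ e u, ends e = s(w, u) ∧ u ∈ region ends x a c) →
        ReflTransGen (fun u w => w ∈ nbr ends x true u ∧
          u ∉ region ends x a c ∧ w ∉ region ends x a c) a w)).card =
      ((lSet ends a b c).filter fun x =>
        (∀ w, w ∉ region ends x a c → (∃ e u, ends e = s(w, u) ∧ u ∈ region ends x a c) →
          ReflTransGen (fun u w => w ∈ nbr ends x true u ∧
            u ∉ region ends x a c ∧ w ∉ region ends x a c) a w) ∧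
        Nat.card (fromEdgeSet {s : Sym2 V | ∃ e, x e = true ∧ ends e = s}).ConnectedComponent +
          Nat.card (fromEdgeSet {s : Sym2 V | ∃ e, x e = false ∧ ends e = s}).ConnectedComponent = t).card := by
    congr 1
    exact Finset.filter_congr fun x _ => ⟨fun h => ⟨h.2, h.1.2⟩, fun h => ⟨⟨Or.inl h.1, h.2⟩, h.1⟩⟩
  have eL2 : ((lSet ends a b c).filter fun x =>
      (((∀ w, w ∉ region ends x a c → (∃ e u, ends e = s(w, u) ∧ u ∈ region ends x a c) →
            ReflTransGen (fun u w => w ∈ nbr ends x true u ∧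
              u ∉ region ends x a c ∧ w ∉ region ends x a c) a w) ∨
          (∀ w, w ∉ region ends x a b → (∃ e u, ends e = s(w, u) ∧ u ∈ region ends x a b) →
            ReflTransGen (fun u w => w ∈ nbr ends x true u ∧
              u ∉ region ends x a b ∧ w ∉ region ends x a b) a w)) ∧
        Nat.card (fromEdgeSet {s : Sym2 V | ∃ e, x e = true ∧ ends e = s}).ConnectedComponent +
          Nat.card (fromEdgeSet {s : Sym2 V | ∃ e, x e = false ∧ ends e = s}).ConnectedComponent = t) ∧
      ¬ (∀ w, w ∉ region ends x a c → (∃ e u, ends e = s(w, u) ∧ u ∈ region ends x a c) →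
        ReflTransGen (fun u w => w ∈ nbr ends x true u ∧
          u ∉ region ends x a c ∧ w ∉ region ends x a c) a w)).card =
      ((lSet ends a b c).filter fun x =>
        (¬ ∀ w, w ∉ region ends x a c → (∃ e u, ends e = s(w, u) ∧ u ∈ region ends x a c) →
          ReflTransGen (fun u w => w ∈ nbr ends x true u ∧
            u ∉ region ends x a c ∧ w ∉ region ends x a c) a w) ∧
        (∀ w, w ∉ region ends x a b → (∃ e u, ends e = s(w, u) ∧ u ∈ region ends x a b) →
          ReflTransGen (fun u w => w ∈ nbr ends x true u ∧
            u ∉ region ends x a b ∧ w ∉ region ends x a b) a w) ∧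
        Nat.card (fromEdgeSet {s : Sym2 V | ∃ e, x e = true ∧ ends e = s}).ConnectedComponent +
          Nat.card (fromEdgeSet {s : Sym2 V | ∃ e, x e = false ∧ ends e = s}).ConnectedComponent = t).card := by
    congr 1
    refine Finset.filter_congr fun x _ => ⟨fun h => ⟨h.2, ?_, h.1.2⟩, fun h => ⟨⟨Or.inr h.2.1, h.2.2⟩, h.1⟩⟩
    rcases h.1.1 with hC | hB
    · exact absurd hC h.2
    · exact hB
  have eR1 : ((rSet ends a b c).filter fun y =>
      (Nat.card (fromEdgeSet {s : Sym2 V | ∃ e, y e = true ∧ ends e = s}).ConnectedComponent +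
        Nat.card (fromEdgeSet {s : Sym2 V | ∃ e, y e = false ∧ ends e = s}).ConnectedComponent = t) ∧
      (∀ w, w ∉ region ends (fun i => !y i) a c →
        (∃ e u, ends e = s(w, u) ∧ u ∈ region ends (fun i => !y i) a c) →
        ReflTransGen (fun u w => w ∈ nbr ends y false u ∧
          u ∉ region ends (fun i => !y i) a c ∧ w ∉ region ends (fun i => !y i) a c) a w)).card =
      ((rSet ends a b c).filter fun y =>
        (∀ w, w ∉ region ends (fun i => !y i) a c →
          (∃ e u, ends e = s(w, u) ∧ u ∈ region ends (fun i => !y i) a c) →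
          ReflTransGen (fun u w => w ∈ nbr ends y false u ∧
            u ∉ region ends (fun i => !y i) a c ∧ w ∉ region ends (fun i => !y i) a c) a w) ∧
        Nat.card (fromEdgeSet {s : Sym2 V | ∃ e, y e = true ∧ ends e = s}).ConnectedComponent +
          Nat.card (fromEdgeSet {s : Sym2 V | ∃ e, y e = false ∧ ends e = s}).ConnectedComponent = t).card := by
    congr 1; exact Finset.filter_congr fun x _ => and_comm
  have eR2 : ((rSet ends a b c).filter fun y =>
      (Nat.card (fromEdgeSet {s : Sym2 V | ∃ e, y e = true ∧ ends e = s}).ConnectedComponent +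
        Nat.card (fromEdgeSet {s : Sym2 V | ∃ e, y e = false ∧ ends e = s}).ConnectedComponent = t) ∧
      ¬ (∀ w, w ∉ region ends (fun i => !y i) a c →
        (∃ e u, ends e = s(w, u) ∧ u ∈ region ends (fun i => !y i) a c) →
        ReflTransGen (fun u w => w ∈ nbr ends y false u ∧
          u ∉ region ends (fun i => !y i) a c ∧ w ∉ region ends (fun i => !y i) a c) a w)).card =
      ((rSet ends a b c).filter fun y =>
        (¬ ∀ w, w ∉ region ends (fun i => !y i) a c →
          (∃ e u, ends e = s(w, u) ∧ u ∈ region ends (fun i => !y i) a c) →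
          ReflTransGen (fun u w => w ∈ nbr ends y false u ∧
            u ∉ region ends (fun i => !y i) a c ∧ w ∉ region ends (fun i => !y i) a c) a w) ∧
        Nat.card (fromEdgeSet {s : Sym2 V | ∃ e, y e = true ∧ ends e = s}).ConnectedComponent +
          Nat.card (fromEdgeSet {s : Sym2 V | ∃ e, y e = false ∧ ends e = s}).ConnectedComponent = t).card := by
    congr 1; exact Finset.filter_congr fun x _ => and_comm
  rw [eL1, eL2] at splitL
  rw [eR1, eR2] at splitR
  omega

end Counting

end AntipodalR1

end Summit.CriticalPhenomena.PercolationContinuityZ3.Theorems
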